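import Literature.Analysis.FluidPDE.ZerothLaw
import Literature.Analysis.FunctionSpaces.TorusFourierCalculus
import HarnessLib

/-!
# The zeroth law of turbulence: proofs of the forcing-scale facts of `ZerothLaw`

Sibling proof file of `Literature.Analysis.FluidPDE.ZerothLaw`. It discharges the two named facts
about the Doering–Foias body force `f(x) = F Φ(x/ℓ)`, `ℓ = 1/n`, rendered on the unit torus as
`ForcingShape.force Φ n F = fun x => F • Φ (n • x)` (Doering–Foias, JFM 467 (2002), §2):

* `Turb.ForcingShape.force_regular_holds` — for `0 < n` the rescaled force is smooth,
  divergence free and mean zero: the lift of `x ↦ Φ(n • x)` to `ℝ^d` is `y ↦ (lift Φ)(n y)`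
  (`Turb.lift_force`), so smoothness and the divergence (`= n · (div Φ)(n • x)`, chain rule through
  the linear map `y ↦ n y`, `Torus.isDivFree_iff_trace_fderiv_lift`) are inherited from `Φ`, and
  the mean vanishes because the surjective endomorphism `x ↦ n • x` of the compact group `T^d`
  preserves Haar measure (`Turb.measurePreserving_nsmul_unitAddTorus`, from Mathlib's
  `MeasureTheory.Measure.measurePreserving_zsmul` on each circle factor and
  `MeasureTheory.volume_preserving_pi`).
* `Turb.ForcingShape.integral_norm_sq_force_holds` — `‖f‖₂² = F²` for `0 < n`, by the same
  invariance and the normalisation `‖Φ‖₂ = 1`.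
* `meanDissipation_eq_dissipationRate_holds` (appended 2026-08-15) — discharge of the in-tree
  compatibility fact `meanDissipation_eq_dissipationRate` of `ZerothLaw`: for `0 ≤ ν` and flows
  with smooth time slices the spectral mean dissipation `meanDissipation ν u = ⟨ν‖∇u‖₂²⟩`
  (`Torus.eGradNormSq`, `toReal`) equals the Wave0 rate `dissipationRate longTimeAvgSup ν u =
  ν⟨‖∇u‖₂²⟩` (pointwise gradients): slice-wise `Torus.gradNormSq_eq_toReal_eGradNormSq_holds`
  (`TorusFourierCalculus`, whence the extra import), `TurbWave0.gradNormSq = Torus.gradNormSq`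
  definitionally, constants come out of running means (`intervalIntegral.integral_const_mul`, no
  integrability needed) and out of real `limsup`s for nonnegative constants with no boundedness
  hypothesis (`limsup_const_mul_atTop_of_nonneg`, via `Filter.limsup_eq` and
  `Real.sInf_smul_of_nonneg`: both sides take the same junk values).

## References

* C. R. Doering, C. Foias, *Energy dissipation in body-forced turbulence*, J. Fluid Mech. 467
  (2002), 289–306, §2 (the force `F Φ(x/ℓ)`, `‖f‖₂ = F`).
-/

open MeasureTheory Filter Topology Set
open scoped ENNReal NNReal

noncomputable section

namespace Literature.Analysis.FluidPDE

variable {d : Type*} [Fintype d] [DecidableEq d]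

/-! ### The endomorphism `x ↦ n • x` of `T^d` -/

omit [DecidableEq d] in
/-- **Haar invariance under `x ↦ n • x`.** For `0 < n` the surjective continuous endomorphism
`x ↦ n • x` of the compact abelian group `T^d = (ℝ/ℤ)^d` preserves the Haar probability measure
`volume` (factor-wise Mathlib's `Measure.measurePreserving_zsmul` on the circle, assembled by
`volume_preserving_pi`). [folklore] -/
theorem measurePreserving_nsmul_unitAddTorus {n : ℕ} (hn : 0 < n) :
    MeasurePreserving (fun x : UnitAddTorus d => n • x) volume volume := by
  have h1 : MeasurePreserving (fun y : UnitAddCircle => n • y) volume volume := by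
    have h := Measure.measurePreserving_zsmul (volume : Measure UnitAddCircle) (n := (n : ℤ))
      (by exact_mod_cast hn.ne')
    simpa [natCast_zsmul] using h
  have h2 := volume_preserving_pi (fun _ : d => h1)
  exact h2

omit [DecidableEq d] in
/-- **Change of variables `x ↦ n • x` in integrals over `T^d`**: `∫ g(n • x) dx = ∫ g(x) dx` for
`0 < n` and every a.e.-strongly measurable `g` (Haar invariance,
`measurePreserving_nsmul_unitAddTorus`, and `MeasureTheory.integral_map`). [folklore] -/
theorem integral_comp_nsmul {F : Type*} [NormedAddCommGroup F] [NormedSpace ℝ F] {n : ℕ}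
    (hn : 0 < n) {g : UnitAddTorus d → F} (hg : AEStronglyMeasurable g volume) :
    ∫ x, g (n • x) = ∫ x, g x := by
  have h := measurePreserving_nsmul_unitAddTorus (d := d) hn
  have hg' : AEStronglyMeasurable g (Measure.map (fun x : UnitAddTorus d => n • x) volume) := by
    rwa [h.map_eq]
  rw [← integral_map h.measurable.aemeasurable hg', h.map_eq]

omit [Fintype d] [DecidableEq d] in
/-- The covering map intertwines the dilation `y ↦ n y` of `ℝ^d` with the endomorphism
`x ↦ n • x` of `T^d`: `proj (n y) = n • proj y`. [folklore] -/
theorem proj_natCast_smul (n : ℕ) (y : EuclideanSpace ℝ d) :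
    FunctionSpaces.Torus.proj ((n : ℝ) • y) = n • FunctionSpaces.Torus.proj y := by
  funext i
  rw [FunctionSpaces.Torus.proj_smul_apply, Pi.smul_apply, FunctionSpaces.Torus.proj_apply, ← nsmul_eq_mul,
    AddCircle.coe_nsmul]

/-- The lift of the rescaled force to `ℝ^d` is the dilated lift of the shape:
`lift (F Φ(n • ·)) (y) = F • (lift Φ)(n y)`. [folklore] -/
theorem lift_force (Φ : ForcingShape d) (n : ℕ) (F : ℝ) :
    FunctionSpaces.Torus.lift (Φ.force n F) = fun y => F • FunctionSpaces.Torus.lift Φ.shape ((n : ℝ) • y) := by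
  funext y
  simp [ForcingShape.force, FunctionSpaces.Torus.lift, proj_natCast_smul]

/-! ### Discharge of `ForcingShape.force_regular` and `ForcingShape.integral_norm_sq_force` -/

/-- **The rescaled force is smooth, divergence free and mean zero** — discharge of the named
fact `ForcingShape.force_regular` (`ZerothLaw`; Doering–Foias 2002, §2, the force `F Φ(x/ℓ)`).
Smoothness: `lift (F Φ(n • ·)) = F • lift Φ ∘ (n ·)` is a composition of smooth maps.
Divergence: by the chain rule `D(lift f)(y) = F n · D(lift Φ)(n y)`, whose trace is
`F n · div Φ (n • proj y) = 0` (`Torus.isDivFree_iff_trace_fderiv_lift`). Mean: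
`∫ F Φ(n • x) dx = F ∫ Φ(n • x) dx = F ∫ Φ = 0` by Haar invariance of `x ↦ n • x`
(`integral_comp_nsmul`). [cite: DoeringFoias2002, §2] -/
theorem ForcingShape.force_regular_holds : ForcingShape.force_regular (d := d) := by
  intro Φ n hn F
  -- smoothness
  have hlift := lift_force Φ n F
  have hΦ : ContDiff ℝ (⊤ : ℕ∞) (FunctionSpaces.Torus.lift Φ.shape) := Φ.smooth
  have hsm : FunctionSpaces.Torus.IsSmooth (Φ.force n F) := by
    unfold FunctionSpaces.Torus.IsSmooth
    rw [hlift]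
    exact (hΦ.comp (contDiff_const_smul (n : ℝ))).const_smul F
  refine ⟨hsm, ?_, ?_⟩
  · -- divergence free
    have h1 : FunctionSpaces.Torus.IsContDiff 1 (Φ.force n F) := hsm.isContDiff (by simp)
    have hΦ1 : FunctionSpaces.Torus.IsContDiff 1 Φ.shape := Φ.smooth.isContDiff (by simp)
    rw [FunctionSpaces.Torus.isDivFree_iff_trace_fderiv_lift h1]
    intro y
    -- the chain rule for the lift
    have hd : DifferentiableAt ℝ (FunctionSpaces.Torus.lift Φ.shape) ((n : ℝ) • y) :=
      (hΦ.differentiable (by simp)).differentiableAt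
    have hL : HasFDerivAt (fun y : EuclideanSpace ℝ d => (n : ℝ) • y)
        ((n : ℝ) • ContinuousLinearMap.id ℝ (EuclideanSpace ℝ d)) y :=
      (hasFDerivAt_id y).const_smul (n : ℝ)
    have hcomp : HasFDerivAt (fun y : EuclideanSpace ℝ d => F • FunctionSpaces.Torus.lift Φ.shape ((n : ℝ) • y))
        (F • ((fderiv ℝ (FunctionSpaces.Torus.lift Φ.shape) ((n : ℝ) • y)).comp
          ((n : ℝ) • ContinuousLinearMap.id ℝ (EuclideanSpace ℝ d)))) y :=
      (hd.hasFDerivAt.comp y hL).const_smul F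
    rw [hlift, hcomp.fderiv]
    have htr : LinearMap.trace ℝ (EuclideanSpace ℝ d)
        (fderiv ℝ (FunctionSpaces.Torus.lift Φ.shape) ((n : ℝ) • y) :
          EuclideanSpace ℝ d →ₗ[ℝ] EuclideanSpace ℝ d) = 0 :=
      (FunctionSpaces.Torus.isDivFree_iff_trace_fderiv_lift hΦ1).1 Φ.divFree ((n : ℝ) • y)
    have hcoe : ((F • (fderiv ℝ (FunctionSpaces.Torus.lift Φ.shape) ((n : ℝ) • y)).comp
          ((n : ℝ) • ContinuousLinearMap.id ℝ (EuclideanSpace ℝ d)) :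
            EuclideanSpace ℝ d →L[ℝ] EuclideanSpace ℝ d) :
            EuclideanSpace ℝ d →ₗ[ℝ] EuclideanSpace ℝ d) =
        (F * n) • (fderiv ℝ (FunctionSpaces.Torus.lift Φ.shape) ((n : ℝ) • y) :
            EuclideanSpace ℝ d →ₗ[ℝ] EuclideanSpace ℝ d) := by
      ext v
      simp [mul_smul]
    rw [hcoe, map_smul, htr, smul_zero]
  · -- mean zero
    unfold FunctionSpaces.Torus.HasZeroMean ForcingShape.force
    rw [integral_smul, integral_comp_nsmul hn Φ.smooth.continuous.aestronglyMeasurable]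
    have h0 : ∫ x, Φ.shape x = 0 := Φ.zeroMean
    rw [h0, smul_zero]

/-- **`‖f‖₂² = F²`** — discharge of the named fact `ForcingShape.integral_norm_sq_force`
(`ZerothLaw`; Doering–Foias 2002, §2: the amplitude `F` is the `L²` norm of the force for the
normalised shape): `∫ ‖F Φ(n • x)‖² dx = F² ∫ ‖Φ(n • x)‖² dx = F² ∫ ‖Φ‖² = F²` by Haar
invariance of `x ↦ n • x` (`integral_comp_nsmul`) and `‖Φ‖₂ = 1`. [cite: DoeringFoias2002, §2] -/
theorem ForcingShape.integral_norm_sq_force_holds :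
    ForcingShape.integral_norm_sq_force (d := d) := by
  intro Φ n hn F
  unfold ForcingShape.force
  have h1 : ∀ x : UnitAddTorus d, ‖F • Φ.shape (n • x)‖ ^ 2 = F ^ 2 * ‖Φ.shape (n • x)‖ ^ 2 := by
    intro x
    rw [norm_smul, mul_pow, Real.norm_eq_abs, sq_abs]
  simp_rw [h1]
  rw [integral_const_mul,
    integral_comp_nsmul hn (g := fun x => ‖Φ.shape x‖ ^ 2)
      (Φ.smooth.continuous.norm.pow 2).aestronglyMeasurable,
    Φ.sq_norm_eq_one, mul_one]

/-! ### Discharge of `meanDissipation_eq_dissipationRate` -/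

section MeanDissipationRate

open scoped Pointwise

omit [Fintype d] [DecidableEq d] in
/-- Real `limsup` along `atTop` commutes with multiplication by a nonnegative constant, with no
boundedness hypotheses: `limsup_T (c · a T) = c · limsup_T a T` for `0 ≤ c` (for `c > 0` the
sets of eventual upper bounds correspond under `x ↦ c x` and `Real.sInf_smul_of_nonneg` covers the
empty / unbounded junk cases; for `c = 0` both sides vanish). [folklore] -/
theorem limsup_const_mul_atTop_of_nonneg {c : ℝ} (hc : 0 ≤ c) (a : ℝ → ℝ) :
    limsup (fun T => c * a T) atTop = c * limsup a atTop := by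
  rcases hc.eq_or_lt with rfl | hc'
  · simp only [zero_mul]
    exact limsup_const 0
  · have hset : {x : ℝ | ∀ᶠ T in atTop, c * a T ≤ x} =
        c • {x : ℝ | ∀ᶠ T in atTop, a T ≤ x} := by
      ext x
      simp only [Set.mem_setOf_eq, Set.mem_smul_set, smul_eq_mul]
      constructor
      · intro hx
        refine ⟨x / c, ?_, by field_simp⟩
        filter_upwards [hx] with T hT
        rw [le_div_iff₀ hc', mul_comm]
        exact hT
      · rintro ⟨y, hy, rfl⟩
        filter_upwards [hy] with T hT
        exact mul_le_mul_of_nonneg_left hT hc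
    rw [Filter.limsup_eq, Filter.limsup_eq, hset, Real.sInf_smul_of_nonneg hc, smul_eq_mul]

omit [Fintype d] [DecidableEq d] in
/-- Nonnegative constants come out of the `limsup` long-time average:
`⟨c g⟩ = c ⟨g⟩` for `0 ≤ c`, with no integrability or boundedness hypotheses (running means:
`intervalIntegral.integral_const_mul`; `limsup`: `limsup_const_mul_atTop_of_nonneg`). [folklore] -/
theorem longTimeAvgSup_const_mul {c : ℝ} (hc : 0 ≤ c) (g : ℝ → ℝ) :
    longTimeAvgSup (fun t => c * g t) = c * longTimeAvgSup g := by
  unfold longTimeAvgSup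
  have h : timeMean (fun t => c * g t) = fun T => c * timeMean g T := by
    funext T
    unfold timeMean
    rw [intervalIntegral.integral_const_mul]
    ring
  rw [h]
  exact limsup_const_mul_atTop_of_nonneg hc _

/-- **Discharge of `meanDissipation_eq_dissipationRate`** (`ZerothLaw`): for `0 ≤ ν` and a flow
with smooth time slices, `meanDissipation ν u = dissipationRate longTimeAvgSup ν u`, i.e. the
spectral `⟨ν‖∇u‖₂²⟩` (via `Torus.eGradNormSq` and `toReal`) is the Wave0 `ν⟨‖∇u‖₂²⟩` with
pointwise gradients. Slice-wise `Torus.gradNormSq (u t) = (Torus.eGradNormSq (u t)).toReal`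
(`Torus.gradNormSq_eq_toReal_eGradNormSq_holds`), `TurbWave0.gradNormSq = Torus.gradNormSq` by
`rfl`, and `longTimeAvgSup_const_mul`. [folklore] -/
theorem meanDissipation_eq_dissipationRate_holds :
    meanDissipation_eq_dissipationRate (d := d) := by
  intro ν hν u hu
  unfold meanDissipation dissipationRate
  have hpt : (fun t => ν * (FunctionSpaces.Torus.eGradNormSq (u t)).toReal) =
      fun t => ν * TurbWave0.gradNormSq (u t) := by
    funext t
    rw [← FunctionSpaces.Torus.gradNormSq_eq_toReal_eGradNormSq_holds (hu t)]
    rfl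
  rw [hpt, longTimeAvgSup_const_mul hν]

end MeanDissipationRate

end Literature.Analysis.FluidPDE

end
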